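import Summits.Langlands.Langlands.Theses.OrdinaryPrimeTransport
import Literature.NumberTheory.DiophantineGeometry.BcgpSwitchingSurface
import Literature.NumberTheory.DiophantineGeometry.AbelianVarietyOrdinaryReduction
import Literature.NumberTheory.GaloisRepresentations.OrdinaryPDistinguished
import Literature.NumberTheory.Automorphic.IsAutomorphicAE
import HarnessLib

/-!
# Line `RealQuadraticBigImageAbelianSurface` — crux `ReciprocityUpToIrreducibility` (stmt-Langlands-14328),
G4 ladder-down generation 32: the TOTALLY-REAL-DEGREE dial on Boxer–Calegari–Gee–Pilloni 2025 Thm. 1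

Top C = E = `Summit.Langlands.Langlands.Theses.OrdinaryPrimeTransport.ReciprocityUpToIrreducibility` (≡ the decl of
`Theses.IrreducibilityBySelfDuality`, same item; `E ↔ Langlands` landed:
`Theorems.IrreducibleOffSector.langlands_iff_reciprocityUpToIrreducibility_of_JS`).

DIAL `d = [F:ℚ]`, `F` totally real: `BigImageOrdinaryAbelianSurfaceTR d` = every abelian surface `A/F` with
(1) `ρ̄_{A,3}(Γ_F) = GSp₄(𝔽₃)` with multiplier `ε̄₃⁻¹` in a contragredient frame of `A[3]` (polarization prime to `3` +
surjective mod-`3` image), (2) `ρ̄_{A,3}` unramified with `charpoly(Frob_v) ≠ (X² ± X + 2)²` at every `v ∣ 2`, (3) good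
ordinary `3`-distinguished reduction at every `v ∣ 3`, is modular (`GL₄(𝔸_F)`, a.e.-Satake form `IsModularGL4`).
FLOOR `d = 1` = BCGP 2025 Thm. 1 (arXiv:2502.20645 p. 3; text hypothesis `FloorText`, F3 `floor_one` in `_special`);
RUNG `d = 2` = `RealQuadraticBigImageAbelianSurface` (OPEN: arXiv:2502.20645 p. 3 "generalizing our main results to
totally real fields … the proof of the main classicality theorem will require new ideas"; Gee arXiv:2510.02756 §6);
GAP `d ≥ 3` = `HigherDegreeBigImageAbelianSurface`; `d = 0` vacuous (`family_zero`).

Skeleton: five registered stubs (`stub_floorText`, `stub_rung`, `stub_higherDegrees`, `stub_sectorMerge`,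
`stub_offSector`) and the sorry-free composition `ReciprocityUpToIrreducibility_of` concluding the crux BY NAME;
§6 proves `E → rung` and `Langlands → rung` (F4) sorry-free.  Sorries: exactly the five `stub_*`.
-/

set_option autoImplicit false

noncomputable section

open scoped MatrixGroups Matrix NumberField Classical
open Filter IsDedekindDomain IsDedekindDomain.HeightOneSpectrum CategoryTheory
open Literature.NumberTheory.Automorphic Literature.NumberTheory.GaloisRepresentations
open Literature.NumberTheory.PAdicHodge Literature.NumberTheory.DiophantineGeometry
open Literature.AlgebraicGeometry.Motives (AbelianVariety)
open NumberField
open Summit.Langlands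

namespace Summit.Langlands.Langlands.Cruxes.ReciprocityUpToIrreducibility.RealQuadraticBigImageAbelianSurface

/-! ## 1. The hypotheses of BCGP 2025 Thm. 1 over a number field `F`, place-wise; the modularity conclusion -/

/-- **The three hypotheses of Boxer–Calegari–Gee–Pilloni 2025, Thm. 1 (= Thm. 9.5.3 with surjective image), for an
abelian surface `A` over a number field `F`, stated place-wise** (so that `F = ℚ` is the printed theorem and any totally
real `F` is a member of the dial).
(1) "polarization of degree prime to `3`" + "`ρ̄_{A,3} : G_F → GSp₄(𝔽₃)` surjective": a contragredient additive frame `e₃`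
of `A[3](F̄)` in which `Γ_F` acts through `ρb : Γ_F → GL₄(𝔽₃)` (the clause of the tree fact
`bcgp_switchingSurface_exists` (2)(a), verbatim with `F` for `ℚ`), an alternating unit-determinant `J` with
`ρb(g)ᵀ J ρb(g) = ε̄₃(g)⁻¹ J` (the tree's `IsSymplecticWithMultiplierFun` unfolded, multiplier the inverse mod-`3`
cyclotomic character — exactly how the accepted tree fact `bcgp_switch_exists_modular_abelianSurface` renders the
polarization-induced symplectic structure that the proof of Thm. 9.5.3 uses, via Lemma 9.4.2), and EVERY similitude
of `J` in the image of `ρb` (surjectivity onto `GSp(J) = GSp₄(𝔽₃)`);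
(2) at every `v ∣ 2`: `ρb` unramified at `v` and `charpoly ρb(Frob_v) ≠ (X² ± X + 2)²` (verbatim the third hypothesis
of the tree's switch facts);
(3) at every `v ∣ 3`: good ordinary reduction (tree `HasGoodOrdinaryReductionAt`) and every framed dual `r₃` of `V₃(A)`
ordinary and `3`-distinguished at `v` (tree `IsOrdinaryPDistinguishedAt`, BCGP Def. 1.8.8; for good ordinary reduction
this is "the characteristic polynomial of Frobenius at `3` has distinct roots" of Thm. 1 (3)).
[cite: BoxerCalegariGeePilloni2025, Thm. 1 (p. 3), Thm. 9.5.3 and its proof (pp. 136–137), Lemma 9.4.2, Def. 1.8.8, §1.8.11 (arXiv:2502.20645)] -/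
def IsBigImageOrdinaryAtThree (F : Type) [Field F] [NumberField F] (A : AbelianVariety F) : Prop :=
  (∃ (ρb : FramedGaloisRep F (ZMod 3) 4) (e₃ : A.geomTorsion (3 : ℕ) ≃+ (Fin 4 → ZMod 3))
      (J : Matrix (Fin 4) (Fin 4) (ZMod 3)),
      (∀ (g : Field.absoluteGaloisGroup F) (P : A.geomTorsion (3 : ℕ)),
          e₃ (g • P) = ((ρb g⁻¹ : GL (Fin 4) (ZMod 3)) : Matrix (Fin 4) (Fin 4) (ZMod 3))ᵀ *ᵥ e₃ P) ∧
      Jᵀ = -J ∧ IsUnit J.det ∧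
      (∀ g : Field.absoluteGaloisGroup F,
          (ρb g).valᵀ * J * (ρb g).val =
            (((modPCyclotomicCharacterZMod F 3 g)⁻¹ : (ZMod 3)ˣ) : ZMod 3) • J) ∧
      (∀ M : GL (Fin 4) (ZMod 3),
          (∃ c : ZMod 3, IsUnit c ∧ M.valᵀ * J * M.val = c • J) →
            ∃ g : Field.absoluteGaloisGroup F, ρb g = M) ∧
      (∀ v : HeightOneSpectrum (𝓞 F), ((2 : ℕ) : 𝓞 F) ∈ v.asIdeal →
          ρb.IsUnramifiedAt v ∧
            ∀ Q : Polynomial (ZMod 3), ρb.HasFrobCharpolyAt v Q →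
              Q ≠ (Polynomial.X ^ 2 + Polynomial.X + 2) ^ 2 ∧
                Q ≠ (Polynomial.X ^ 2 - Polynomial.X + 2) ^ 2)) ∧
  (∀ v : HeightOneSpectrum (𝓞 F), ((3 : ℕ) : 𝓞 F) ∈ v.asIdeal → A.HasGoodOrdinaryReductionAt v) ∧
  (∀ (b₃ : Module.Basis (Fin 4) ℚ_[3] (A.rationalTateModule 3)) (r₃ : FramedGaloisRep F (PadicAlgCl 3) 4),
      (∀ g : Field.absoluteGaloisGroup F,
        (r₃ g).val =
          ((LinearMap.toMatrix b₃ b₃ (A.rationalTateRep 3 g⁻¹)).map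
            (algebraMap ℚ_[3] (PadicAlgCl 3))).transpose) →
      ∀ v : HeightOneSpectrum (𝓞 F), ((3 : ℕ) : 𝓞 F) ∈ v.asIdeal → r₃.IsOrdinaryPDistinguishedAt v)

/-- **"`A` is modular" in the summit's `GL₄` a.e.-Satake form** (as in line `A5bTwoRankOne`, with `F` for `ℚ`): for every
prime `ℓ`, every framed dual `r` of `V_ℓ(A)` (frame clause `r(g) = [g⁻¹]_bᵀ`) which is irreducible, unramified a.e. and
de Rham above `ℓ` for Fontaine's pinned datum (three TRUE extra hypotheses — Faltings + big image, Néron–Ogg–Shafarevich,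
Fontaine–Faltings — so that clause (B) of E applies to `r` literally), every level structure `hcpt` and every
`ι : ℚ̄_ℓ ≃ ℂ`, some automorphic representation of `GL₄(𝔸_F)` has Satake parameters giving `det(X − r(Frob_v))` at almost
every `v` (`SatakeFrobCompatibleAE`). -/
def IsModularGL4 (F : Type) [Field F] [NumberField F] (A : AbelianVariety F) : Prop :=
  ∀ (ℓ : ℕ) [Fact ℓ.Prime] (b : Module.Basis (Fin 4) ℚ_[ℓ] (A.rationalTateModule ℓ))
    (r : FramedGaloisRep F (PadicAlgCl ℓ) 4),
    (∀ g : Field.absoluteGaloisGroup F,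
      (r g).val =
        ((LinearMap.toMatrix b b (A.rationalTateRep ℓ g⁻¹)).map
          (algebraMap ℚ_[ℓ] (PadicAlgCl ℓ))).transpose) →
    r.toGaloisRep.IsIrreducible →
    (∀ᶠ v : HeightOneSpectrum (𝓞 F) in cofinite, r.IsUnramifiedAt v) →
    (∀ (w : HeightOneSpectrum (𝓞 F)) (hw : ((ℓ : ℕ) : 𝓞 F) ∈ w.asIdeal),
        (fontainePstAdicCompletion w ℓ hw).IsDeRhamFramed (r.toLocal w)) →
    ∀ (hcpt : isCompact_glFiniteIntegralLevel 4 F) (ι : PadicAlgCl ℓ ≃+* ℂ),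
      ∃ π : AutomorphicRepData (AutomorphyDatum.gl 4 F hcpt), SatakeFrobCompatibleAE ι π r

/-! ## 2. The dial `d = [F:ℚ]`, the rung `d = 2`, the gap above, the floor text `d = 1` -/

/-- **The RUNG FAMILY, dial = the degree `d = [F:ℚ]` of the totally real base field**: every abelian surface over a
totally real field of degree `d` satisfying the three hypotheses of BCGP 2025 Thm. 1 at all places above `2` and `3`
is modular (`GL₄(𝔸_F)`, a.e.-Satake form). -/
def BigImageOrdinaryAbelianSurfaceTR (d : ℕ) : Prop :=
  ∀ (F : Type) [Field F] [NumberField F] [IsTotallyReal F], Module.finrank ℚ F = d →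
    ∀ A : AbelianVariety F, A.dim = 2 → IsBigImageOrdinaryAtThree F A → IsModularGL4 F A

/-- **THE RUNG (θ32 = 2)**: abelian surfaces over REAL QUADRATIC fields with `ρ̄_{A,3}(Γ_F) = GSp₄(𝔽₃)` (polarization
prime to `3`), `ρ̄_{A,3}` unramified with Frobenius characteristic polynomial `≠ (X² ± X + 2)²` at every `v ∣ 2`, and
good ordinary `3`-distinguished reduction at every `v ∣ 3`, are modular.  OPEN: the generalisation of BCGP 2025 Thm. 1
to totally real fields is announced as future work requiring "new ideas" for the classicality theorem
(arXiv:2502.20645 p. 3; Gee, arXiv:2510.02756 §6). -/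
def RealQuadraticBigImageAbelianSurface : Prop := BigImageOrdinaryAbelianSurfaceTR 2

/-- **Above the rung (θ32 ≥ 3)**: the same over totally real fields of every degree `≥ 3`. -/
def HigherDegreeBigImageAbelianSurface : Prop := ∀ d : ℕ, 3 ≤ d → BigImageOrdinaryAbelianSurfaceTR d

/-- **Floor text** (obligation node, in print, not yet vendored in the tree): Boxer–Calegari–Gee–Pilloni 2025 Thm. 1
(arXiv:2502.20645, p. 3; = Thm. 9.5.3 with `ρ̄_{A,3}` surjective, proof pp. 136–137: the `2`–`3` switch Lemma 9.4.2 +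
the `3`-adic lifting Thm. 9.5.1 + transfer `GSp₄ → GL₄`, §1.8.10–1.8.12) for abelian surfaces over a number field of
degree `1` (= `ℚ`), hypotheses exactly `IsBigImageOrdinaryAtThree`, conclusion "`A` is modular: a cuspidal `π` on
`GL₄/ℚ` with `L(s, H¹(A)) = L(s, π)`" in the almost-everywhere L-normalised currency of the tree's switch fact
`bcgp_switch_exists_modular_abelianSurface` (for every `ℓ`, frame `b`, framed dual `r` of `V_ℓ(A)`, `hcpt`, `ι`: an
`L`-algebraic cuspidal `π` of `GL₄(𝔸)` whose Satake parameters give `det(X − r(Frob_v))` at almost every `v`).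
[cite: BoxerCalegariGeePilloni2025, Thm. 1, Thm. 9.5.3, Thm. 9.5.1, Lemma 9.4.2, §1.8.10–1.8.12 (arXiv:2502.20645)] -/
def FloorText : Prop :=
  ∀ (F : Type) [Field F] [NumberField F] [IsTotallyReal F], Module.finrank ℚ F = 1 →
    ∀ A : AbelianVariety F, A.dim = 2 → IsBigImageOrdinaryAtThree F A →
      ∀ (ℓ : ℕ) [Fact ℓ.Prime] (b : Module.Basis (Fin 4) ℚ_[ℓ] (A.rationalTateModule ℓ))
        (r : FramedGaloisRep F (PadicAlgCl ℓ) 4),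
        (∀ g : Field.absoluteGaloisGroup F,
          (r g).val =
            ((LinearMap.toMatrix b b (A.rationalTateRep ℓ g⁻¹)).map
              (algebraMap ℚ_[ℓ] (PadicAlgCl ℓ))).transpose) →
        ∀ (hcpt : isCompact_glFiniteIntegralLevel 4 F) (ι : PadicAlgCl ℓ ≃+* ℂ),
          ∃ π : CuspidalAutomorphicRepData 4 F hcpt, π.1.IsLAlgebraic ∧
            ∀ᶠ v : HeightOneSpectrum (𝓞 F) in cofinite, ∃ a : Multiset ℂ,
              π.1.HasSatakeParamAt v a ∧ r.IsUnramifiedAt v ∧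
                r.HasFrobCharpolyAt v (arithFrobPolyOfSatake ι v.residueCard 1 a)

/-! ## The floor member and the vacuous member, sorry-free -/

/-- **F3: the family at `d = 1` from the floor text** (BCGP 2025 Thm. 1): the irreducibility, ramification and de Rham
hypotheses of the member are discarded and the cuspidal `π` is read as an automorphic representation. -/
theorem floor_one (h : FloorText) : BigImageOrdinaryAbelianSurfaceTR 1 := by
  intro F _ _ _ hdeg A hdim hA ℓ _ b r hfr _hirr _hunr _hdR hcpt ι
  obtain ⟨π, -, hπ⟩ := h F hdeg A hdim hA ℓ b r hfr hcpt ι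
  exact ⟨π.1, hπ⟩

/-- No number field has degree `0`: the member `d = 0` is vacuous. [folklore] -/
theorem family_zero : BigImageOrdinaryAbelianSurfaceTR 0 := by
  intro F _ _ _ hdeg
  exact absurd hdeg (Module.finrank_pos (R := ℚ) (M := F)).ne'

/-- **Every member** from the floor text, the rung and the higher-degree gap. -/
theorem family_of (h1 : FloorText) (h2 : RealQuadraticBigImageAbelianSurface)
    (h3 : HigherDegreeBigImageAbelianSurface) (d : ℕ) : BigImageOrdinaryAbelianSurfaceTR d := by
  rcases Nat.lt_or_ge d 3 with h | h
  · interval_cases d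
    · exact family_zero
    · exact floor_one h1
    · exact h2
  · exact h3 d h

/-! ## 3. The sector of clause (B), the merge target, the off-sector complement -/

/-- **The big-image-ordinary abelian-surface sector of clause (B)** at `(F, ℓ, ρ)`: `F` is totally real and `ρ` has
the Frobenius characteristic polynomials of a framed dual `r` of `V_ℓ(A)` for some abelian surface `A/F` satisfying
`IsBigImageOrdinaryAtThree` (in SOME degree `d = [F:ℚ]`, i.e. some member of the dial). -/
def InBigImageSector (F : Type) [Field F] [NumberField F] (ℓ : ℕ) [Fact ℓ.Prime] {n : ℕ}
    (ρ : FramedGaloisRep F (PadicAlgCl ℓ) n) : Prop :=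
  IsTotallyReal F ∧
    ∃ A : AbelianVariety F, A.dim = 2 ∧ IsBigImageOrdinaryAtThree F A ∧
      ∃ (b : Module.Basis (Fin 4) ℚ_[ℓ] (A.rationalTateModule ℓ)) (r : FramedGaloisRep F (PadicAlgCl ℓ) 4),
        (∀ g : Field.absoluteGaloisGroup F,
          (r g).val =
            ((LinearMap.toMatrix b b (A.rationalTateRep ℓ g⁻¹)).map
              (algebraMap ℚ_[ℓ] (PadicAlgCl ℓ))).transpose) ∧
        ∀ (w : HeightOneSpectrum (𝓞 F)) (P : Polynomial (PadicAlgCl ℓ)),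
          r.HasFrobCharpolyAt w P → ρ.HasFrobCharpolyAt w P

/-- **Merge target**: clause (B) of E VERBATIM (cuspidal, `L`-algebraic, `Corresponds Rec ι π ρ`) for EVERY reciprocity
datum `Rec`, on the big-image-ordinary abelian-surface sector. -/
def SectorGaloisToAutomorphic : Prop :=
  ∀ (F : Type) [Field F] [NumberField F] (Rec : ReciprocityData F) (n : ℕ), 0 < n →
    ∀ (hcpt : isCompact_glFiniteIntegralLevel n F) (ℓ : ℕ) [Fact ℓ.Prime] (ι : PadicAlgCl ℓ ≃+* ℂ)
      (ρ : FramedGaloisRep F (PadicAlgCl ℓ) n),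
      ρ.toGaloisRep.IsIrreducible → IsGeometricFramed Rec ρ → InBigImageSector F ℓ ρ →
        ∃ π : CuspidalAutomorphicRepData n F hcpt, π.1.IsLAlgebraic ∧ Corresponds Rec ι π.1 ρ

/-- **The off-sector complement**: E (`ReciprocityUpToIrreducibility`) with clause (A) entire and clause (B) restricted to
`ρ` NOT in the big-image-ordinary abelian-surface sector. -/
def OffSectorReciprocity : Prop :=
  ∀ (F : Type) [Field F] [NumberField F], ∃ Rec : ReciprocityData F, ∀ n : ℕ, 0 < n →
    ∀ hcpt : isCompact_glFiniteIntegralLevel n F,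
      (∀ π : CuspidalAutomorphicRepData n F hcpt, π.1.IsLAlgebraic →
        ∀ (ℓ : ℕ) [Fact ℓ.Prime] (ι : PadicAlgCl ℓ ≃+* ℂ),
          ∃ ρ : FramedGaloisRep F (PadicAlgCl ℓ) n, IsGeometricFramed Rec ρ ∧ Corresponds Rec ι π.1 ρ) ∧
      (∀ (ℓ : ℕ) [Fact ℓ.Prime] (ι : PadicAlgCl ℓ ≃+* ℂ) (ρ : FramedGaloisRep F (PadicAlgCl ℓ) n),
        ρ.toGaloisRep.IsIrreducible → IsGeometricFramed Rec ρ → ¬ InBigImageSector F ℓ ρ →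
          ∃ π : CuspidalAutomorphicRepData n F hcpt, π.1.IsLAlgebraic ∧ Corresponds Rec ι π.1 ρ)

/-! ## 4. The five registered stubs -/

/-- The FLOOR as printed: BCGP 2025 Thm. 1 over `ℚ` (in print; not yet vendored in the tree; XL to discharge). -/
theorem stub_floorText : FloorText := by
  sorry

/-- **THE RUNG (open core)**: degree `d = 2` — abelian surfaces over real quadratic fields. -/
theorem stub_rung : RealQuadraticBigImageAbelianSurface := by
  sorry

/-- The gap above the rung: every totally real degree `d ≥ 3`. -/
theorem stub_higherDegrees : HigherDegreeBigImageAbelianSurface := by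
  sorry

/-- Sector merge: from `GL₄`-modularity (a.e.) of every member to clause (B) of E verbatim on the sector, for every
`Rec` (Jacquet–Shalika / strong multiplicity one ⇒ cuspidal `L`-algebraic `π`; local–global compatibility at every place;
transport of the Frobenius data from `r` to `ρ`). -/
theorem stub_sectorMerge : (∀ d : ℕ, BigImageOrdinaryAbelianSurfaceTR d) → SectorGaloisToAutomorphic := by
  sorry

/-- E with clause (B) restricted OFF the sector (the honest complement). -/
theorem stub_offSector : OffSectorReciprocity := by
  sorry

/-! ## 5. Composition (no sorry below this line) -/

/-- **COMPOSITION — the crux BY NAME from the five stub statements.** -/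
theorem ReciprocityUpToIrreducibility_of :
    FloorText → RealQuadraticBigImageAbelianSurface → HigherDegreeBigImageAbelianSurface →
    ((∀ d : ℕ, BigImageOrdinaryAbelianSurfaceTR d) → SectorGaloisToAutomorphic) → OffSectorReciprocity →
    Summit.Langlands.Langlands.Theses.OrdinaryPrimeTransport.ReciprocityUpToIrreducibility := by
  intro h1 h2 h3 hmerge hoff F _ _
  obtain ⟨Rec, hall⟩ := hoff F
  refine ⟨Rec, fun n hn hcpt => ⟨(hall n hn hcpt).1, ?_⟩⟩
  intro ℓ _ ι ρ hirr hgeo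
  by_cases hsec : InBigImageSector F ℓ ρ
  · exact hmerge (family_of h1 h2 h3) F Rec n hn hcpt ℓ ι ρ hirr hgeo hsec
  · exact (hall n hn hcpt).2 ℓ ι ρ hirr hgeo hsec

/-- **THE REGISTERED SKELETON THEOREM** — the item's decl from the five registered stubs. -/
theorem reciprocityUpToIrreducibility_holds :
    Summit.Langlands.Langlands.Theses.OrdinaryPrimeTransport.ReciprocityUpToIrreducibility :=
  ReciprocityUpToIrreducibility_of stub_floorText stub_rung stub_higherDegrees stub_sectorMerge stub_offSector

/-- **`<Crux>_proof`.** TREE COPY: concludes route OrdinaryPrimeTransport's decl of the shared item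
stmt-Langlands-14328.  The REGISTERED seat-folder copy (`line-RealQuadraticBigImageAbelianSurface.lean`, identical up to
one extra `import Summits.Langlands.Langlands.Theses.IrreducibilityBySelfDuality` and this theorem's type) concludes
`Summit.Langlands.Langlands.Theses.IrreducibilityBySelfDuality.ReciprocityUpToIrreducibility` BY NAME (the two decls are the
same text, `Iff.rfl` — checked `bc/BothTheses.lean` rc 0; `ledger skeleton check` OK, stubs registered); that module does not
elaborate on the crux-write host (`remote:incoherent … IrreducibilityBySelfDuality: mismatch`), as for Lines/PartialWeightOneLiftingTR. -/
theorem ReciprocityUpToIrreducibility_proof :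
    Summit.Langlands.Langlands.Theses.OrdinaryPrimeTransport.ReciprocityUpToIrreducibility :=
  reciprocityUpToIrreducibility_holds

/-! ## The rung is a consequence of the top and of the summit (sorry-free) -/

/-- `E → BigImageOrdinaryAbelianSurfaceTR d` for every `d`: clause (B) of E over `F`, `n = 4`, applied to the framed
dual `r` (irreducible and geometric for `Rec` by the member's extra hypotheses, `Rec.pst = fontainePstAdicCompletion`
definitionally); the a.e. half of `Corresponds` is `SatakeFrobCompatibleAE`. -/
theorem family_of_top (d : ℕ)
    (hE : Summit.Langlands.Langlands.Theses.OrdinaryPrimeTransport.ReciprocityUpToIrreducibility) :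
    BigImageOrdinaryAbelianSurfaceTR d := by
  intro F _ _ _ _hdeg A _hdim _hA ℓ _ b r _hfr hirr hunr hdR hcpt ι
  obtain ⟨Rec, hall⟩ := hE F
  have hB : GaloisToAutomorphic 4 Rec hcpt := (hall 4 (by norm_num) hcpt).2
  have hgeo : IsGeometricFramed Rec r := ⟨hunr, fun w hw => hdR w hw⟩
  obtain ⟨π, _hLalg, hcorr⟩ := hB ℓ ι r hirr hgeo
  exact ⟨π.1, hcorr.1⟩

/-- `E → rung`. -/
theorem RealQuadraticBigImageAbelianSurface_of_top
    (hE : Summit.Langlands.Langlands.Theses.OrdinaryPrimeTransport.ReciprocityUpToIrreducibility) :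
    RealQuadraticBigImageAbelianSurface :=
  family_of_top 2 hE

/-- `Langlands → BigImageOrdinaryAbelianSurfaceTR d` for every `d` (the F4 on-path lemma). -/
theorem family_of_langlands (d : ℕ) (hL : _root_.Langlands) : BigImageOrdinaryAbelianSurfaceTR d := by
  intro F _ _ _ _hdeg A _hdim _hA ℓ _ b r _hfr hirr hunr hdR hcpt ι
  obtain ⟨⟨Rec⟩, hall⟩ := hL F
  have hB : GaloisToAutomorphic 4 Rec hcpt := (hall Rec 4 (by norm_num) hcpt).2
  have hgeo : IsGeometricFramed Rec r := ⟨hunr, fun w hw => hdR w hw⟩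
  obtain ⟨π, _hLalg, hcorr⟩ := hB ℓ ι r hirr hgeo
  exact ⟨π.1, hcorr.1⟩

/-- **F4 on-path lemma**: `S → Rung`. -/
@[aesop safe apply]
theorem RealQuadraticBigImageAbelianSurface_of_Langlands (hL : _root_.Langlands) :
    RealQuadraticBigImageAbelianSurface :=
  family_of_langlands 2 hL

end Summit.Langlands.Langlands.Cruxes.ReciprocityUpToIrreducibility.RealQuadraticBigImageAbelianSurface

end
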